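import Summits.ResolutionOfSingularities.ResolutionOfSingularities.Theorems.HomologicalConductorNoZenoPointBlowupTwoChartAlgebra
import HarnessLib

/-!
# Crux `NoZenoR` (stmt-ResolutionOfSingularities-19943), slot 5 `stub_L1wCoreF`, (B1) UP-5 — part 3/3 (algebra):
# the lengths of the equalisers `E₁ ≅ A/𝔪` and `E₂` (`ℓ(E₂) = 3 ℓ(A/𝔪)`)

OURS (cell res-hironaka, crux chain W4.4, seat res-L0-w44-stub-1 g11; object UP-5a/b of the (B1) split core of
slot 5 `stub_L1wCoreF`, res-L0-w44-stub-2 L1W-PREP §3.3 / lead B1-CENSUS-g8). Nothing here is a statement of the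
manuscript under review (Hironaka 2017); AI-written, weaker than expert review. Def-free, fact-free.

For the two-chart datum of part 2/3 and any commutative ring `S` over which everything is an algebra
(`IsScalarTower S A Γᵢ`; in the application `S` is the local base and `ℓ_S(A/𝔪) = [κ(x) : κ_S]`):

* `ker_linearMap_eq_span_pair` — `ker (A → Γ₁/(u₁) × Γ₂/(v₂)) = 𝔪`;
* `length_equaliser_one` — the equaliser `E₁ ⊆ Γ₁/(u₁) × Γ₂/(v₂)` of the two maps to `Γ₁₂/(û)` (= the global
  sections of the exceptional curve `F`, part 4) has `ℓ_S(E₁) = ℓ_S(A/𝔪)`;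
* `length_equaliser_two` — the equaliser `E₂ ⊆ Γ₁/(u₁²) × Γ₂/(v₂²)` over `Γ₁₂/(û²)` (= `Γ(2F, 𝒪)`) has
  `ℓ_S(E₂) = 3 · ℓ_S(A/𝔪)`: `0 → (A/𝔪)² → E₂ → E₁ → 0` via `λ` of part 2.

The equalisers are taken as ARBITRARY submodules `E` with the membership characterisation `hE`, and the ideals as
variables with defining equations, so that the scheme side (part 4) instantiates them with the sheaf-theoretic
objects verbatim. References: J. Lipman, Publ. Math. IHÉS 36 (1969), §13 (13.1), §15 p. 229, §23 Cor. (23.2)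
[`Lipman1969`]; R. Hartshorne, *Algebraic Geometry* (1977), V Prop. 3.1–3.2 [`Hartshorne1977`].
-/

noncomputable section

-- single-problem summit: the doubled namespace component `ResolutionOfSingularities` is forced
set_option linter.dupNamespace false

namespace Summit.ResolutionOfSingularities.ResolutionOfSingularities.Theorems.NoZeno.ExcCount.PointBlowup

open Polynomial

/-! ## §4 The equalisers `E₁`, `E₂` and their lengths -/

/-- `algebraMap A (Γ/I) = mk ∘ algebraMap A Γ`, pointwise. [folklore] -/
theorem algebraMap_quotient_apply {A Γ : Type*} [CommRing A] [CommRing Γ] [Algebra A Γ]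
    (I : Ideal Γ) (c : A) :
    algebraMap A (Γ ⧸ I) c = Ideal.Quotient.mk I (algebraMap A Γ c) :=
  rfl

section Lengths

variable {S A : Type*} [CommRing S] [CommRing A] [Algebra S A]
  {Γ₁ Γ₂ Γ₁₂ : Type*} [CommRing Γ₁] [CommRing Γ₂] [CommRing Γ₁₂]
  [Algebra A Γ₁] [Algebra A Γ₂] [Algebra A Γ₁₂]
  [Algebra S Γ₁] [Algebra S Γ₂] [IsScalarTower S A Γ₁] [IsScalarTower S A Γ₂]
  (r₁ : Γ₁ →ₐ[A] Γ₁₂) (r₂ : Γ₂ →ₐ[A] Γ₁₂) (u v : A) (T : Γ₁) (T' : Γ₂)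

/-- The kernel of `A → Γ₁/(u₁) × Γ₂/(v₂)` is `𝔪 = (u, v)`. [folklore] -/
theorem ker_linearMap_eq_span_pair
    (ε₁ : (Γ₁ ⧸ (Ideal.span {u, v}).map (algebraMap A Γ₁)) ≃+* (A ⧸ Ideal.span {u, v})[X])
    (hε₁C : ∀ a, ε₁ (Ideal.Quotient.mk _ (algebraMap A Γ₁ a)) = C (Ideal.Quotient.mk _ a))
    (hvu : algebraMap A Γ₁ v = algebraMap A Γ₁ u * T)
    (I₁ : Ideal Γ₁) (hI₁ : I₁ = Ideal.span {algebraMap A Γ₁ u})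
    (I₂ : Ideal Γ₂) (hI₂ : (Ideal.span {u, v}).map (algebraMap A Γ₂) ≤ I₂) :
    LinearMap.ker (Algebra.linearMap A ((Γ₁ ⧸ I₁) × (Γ₂ ⧸ I₂))) =
      (Ideal.span {u, v}).restrictScalars A := by
  subst hI₁
  ext c
  rw [LinearMap.mem_ker, Algebra.linearMap_apply, Prod.algebraMap_apply, Prod.mk_eq_zero,
    algebraMap_quotient_apply, algebraMap_quotient_apply, Ideal.Quotient.eq_zero_iff_mem,
    ← map_span_pair_eq_span_singleton u v T hvu, algebraMap_mem_map_iff _ ε₁ hε₁C,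
    Submodule.restrictScalars_mem]
  constructor
  · exact fun h => h.1
  · intro h
    refine ⟨h, ?_⟩
    rw [Ideal.Quotient.eq_zero_iff_mem]
    exact hI₂ (Ideal.mem_map_of_mem _ h)

/-- **`E₁ ≅ A/𝔪`, in lengths**: the equaliser `E₁` of `Γ₁/(u₁) × Γ₂/(v₂) ⇉ Γ₁₂/(û)` — the
global sections of the exceptional curve, once the scheme side identifies them — has `S`-length
`ℓ_S(A/𝔪)` (`= [κ(x) : κ_S]`). [folklore] -/
theorem length_equaliser_one [IsDomain Γ₁₂]
    (ε₁ : (Γ₁ ⧸ (Ideal.span {u, v}).map (algebraMap A Γ₁)) ≃+* (A ⧸ Ideal.span {u, v})[X])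
    (hε₁C : ∀ a, ε₁ (Ideal.Quotient.mk _ (algebraMap A Γ₁ a)) = C (Ideal.Quotient.mk _ a))
    (hε₁X : ε₁ (Ideal.Quotient.mk _ T) = X)
    (ε₂ : (Γ₂ ⧸ (Ideal.span {u, v}).map (algebraMap A Γ₂)) ≃+* (A ⧸ Ideal.span {u, v})[X])
    (hε₂C : ∀ a, ε₂ (Ideal.Quotient.mk _ (algebraMap A Γ₂ a)) = C (Ideal.Quotient.mk _ a))
    (hε₂X : ε₂ (Ideal.Quotient.mk _ T') = X)
    (hvu : algebraMap A Γ₁ v = algebraMap A Γ₁ u * T)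
    (huv : algebraMap A Γ₂ u = algebraMap A Γ₂ v * T') (hu : algebraMap A Γ₁₂ u ≠ 0)
    (hr₁ : Function.Injective r₁) (hloc : ∀ z : Γ₁₂, ∃ (c : Γ₁) (e : ℕ), r₁ T ^ e * z = r₁ c)
    (hgen₁ : ∀ a : Γ₁, ∃ P : A[X], a = aeval T P) (hgen₂ : ∀ b : Γ₂, ∃ Q : A[X], b = aeval T' Q)
    (hTT' : r₁ T * r₂ T' = 1)
    (I₁ : Ideal Γ₁) (hI₁ : I₁ = Ideal.span {algebraMap A Γ₁ u})
    (I₂ : Ideal Γ₂) (hI₂ : I₂ = Ideal.span {algebraMap A Γ₂ v})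
    (I₁₂ : Ideal Γ₁₂) (hI₁₂ : I₁₂ = Ideal.span {algebraMap A Γ₁₂ u})
    (E : Submodule A ((Γ₁ ⧸ I₁) × (Γ₂ ⧸ I₂)))
    (hE : ∀ (a : Γ₁) (b : Γ₂), (Ideal.Quotient.mk I₁ a, Ideal.Quotient.mk I₂ b) ∈ E ↔
      r₁ a - r₂ b ∈ I₁₂) :
    Module.length S E = Module.length S (A ⧸ Ideal.span {u, v}) := by
  have h𝔪₂ : (Ideal.span {u, v}).map (algebraMap A Γ₂) = Ideal.span {algebraMap A Γ₂ v} := by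
    rw [Set.pair_comm]; exact map_span_pair_eq_span_singleton v u T' huv
  subst hI₁ hI₂ hI₁₂
  set σ := Algebra.linearMap A ((Γ₁ ⧸ Ideal.span {algebraMap A Γ₁ u}) ×
    (Γ₂ ⧸ Ideal.span {algebraMap A Γ₂ v})) with hσ
  have hker : LinearMap.ker σ = (Ideal.span {u, v}).restrictScalars A :=
    ker_linearMap_eq_span_pair u v T ε₁ hε₁C hvu _ rfl _ h𝔪₂.le
  have hrange : LinearMap.range σ = E := by
    apply le_antisymm
    · rintro _ ⟨c, rfl⟩
      rw [hσ, Algebra.linearMap_apply, Prod.algebraMap_apply, algebraMap_quotient_apply,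
        algebraMap_quotient_apply, hE, AlgHom.commutes, AlgHom.commutes, sub_self]
      exact zero_mem _
    · intro z hz
      obtain ⟨a, ha⟩ := Ideal.Quotient.mk_surjective z.1
      obtain ⟨b, hb⟩ := Ideal.Quotient.mk_surjective z.2
      have hz' : (Ideal.Quotient.mk _ a, Ideal.Quotient.mk _ b) ∈ E := by rwa [ha, hb]
      obtain ⟨c, hca, hcb⟩ := exists_sub_algebraMap_mem r₁ r₂ u v T T' ε₁ hε₁C hε₁X ε₂ hε₂C hε₂X
        hvu huv hu hr₁ hloc hgen₁ hgen₂ hTT' a b ((hE a b).mp hz')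
      refine ⟨c, ?_⟩
      rw [hσ, Algebra.linearMap_apply, Prod.algebraMap_apply, algebraMap_quotient_apply,
        algebraMap_quotient_apply, Prod.ext_iff, ← ha, ← hb, Ideal.Quotient.eq, Ideal.Quotient.eq]
      exact ⟨by rw [← neg_sub]; exact Submodule.neg_mem _ hca,
        by rw [← neg_sub]; exact Submodule.neg_mem _ hcb⟩
  let e : (A ⧸ (Ideal.span {u, v}).restrictScalars A) ≃ₗ[A] E :=
    (Submodule.quotEquivOfEq _ _ hker.symm).trans (σ.quotKerEquivRange.trans (LinearEquiv.ofEq _ _ hrange))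
  exact (e.restrictScalars S).length_eq.symm

/-- **`ℓ_S(E₂) = 3 · ℓ_S(A/𝔪)`**: the equaliser `E₂` of `Γ₁/(u₁²) × Γ₂/(v₂²) ⇉ Γ₁₂/(û²)` — the
global sections of the first infinitesimal neighbourhood `2F` of the exceptional curve — is an
extension of `E₁ ≅ A/𝔪` by `(A/𝔪)²` (the sections `κ ⊕ κ·T` of `𝓘_F/𝓘_F² ≅ 𝒪_{ℙ¹}(1)`), so its
`S`-length is `3 ℓ_S(A/𝔪)`. [folklore] -/
theorem length_equaliser_two [IsDomain Γ₁₂]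
    (ε₁ : (Γ₁ ⧸ (Ideal.span {u, v}).map (algebraMap A Γ₁)) ≃+* (A ⧸ Ideal.span {u, v})[X])
    (hε₁C : ∀ a, ε₁ (Ideal.Quotient.mk _ (algebraMap A Γ₁ a)) = C (Ideal.Quotient.mk _ a))
    (hε₁X : ε₁ (Ideal.Quotient.mk _ T) = X)
    (ε₂ : (Γ₂ ⧸ (Ideal.span {u, v}).map (algebraMap A Γ₂)) ≃+* (A ⧸ Ideal.span {u, v})[X])
    (hε₂C : ∀ a, ε₂ (Ideal.Quotient.mk _ (algebraMap A Γ₂ a)) = C (Ideal.Quotient.mk _ a))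
    (hε₂X : ε₂ (Ideal.Quotient.mk _ T') = X)
    (hvu : algebraMap A Γ₁ v = algebraMap A Γ₁ u * T)
    (huv : algebraMap A Γ₂ u = algebraMap A Γ₂ v * T') (hu : algebraMap A Γ₁₂ u ≠ 0)
    (hr₁ : Function.Injective r₁) (hr₂ : Function.Injective r₂)
    (hloc : ∀ z : Γ₁₂, ∃ (c : Γ₁) (e : ℕ), r₁ T ^ e * z = r₁ c)
    (hgen₁ : ∀ a : Γ₁, ∃ P : A[X], a = aeval T P) (hgen₂ : ∀ b : Γ₂, ∃ Q : A[X], b = aeval T' Q)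
    (hTT' : r₁ T * r₂ T' = 1)
    (I₁ : Ideal Γ₁) (hI₁ : I₁ = Ideal.span {algebraMap A Γ₁ u ^ 2})
    (I₂ : Ideal Γ₂) (hI₂ : I₂ = Ideal.span {algebraMap A Γ₂ v ^ 2})
    (I₁₂ : Ideal Γ₁₂) (hI₁₂ : I₁₂ = Ideal.span {algebraMap A Γ₁₂ u ^ 2})
    (E : Submodule A ((Γ₁ ⧸ I₁) × (Γ₂ ⧸ I₂)))
    (hE : ∀ (a : Γ₁) (b : Γ₂), (Ideal.Quotient.mk I₁ a, Ideal.Quotient.mk I₂ b) ∈ E ↔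
      r₁ a - r₂ b ∈ I₁₂) :
    Module.length S E = 3 * Module.length S (A ⧸ Ideal.span {u, v}) := by
  haveI : IsDomain Γ₁ := hr₁.isDomain r₁.toRingHom
  haveI : IsDomain Γ₂ := hr₂.isDomain r₂.toRingHom
  have hu₁ : algebraMap A Γ₁ u ≠ 0 := fun h => hu (by rw [← r₁.commutes, h, map_zero])
  have hv₂ : algebraMap A Γ₂ v ≠ 0 := by
    intro h
    apply hu
    rw [← r₂.commutes, huv, h, zero_mul, map_zero]
  have h𝔪₁ : (Ideal.span {u, v}).map (algebraMap A Γ₁) = Ideal.span {algebraMap A Γ₁ u} :=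
    map_span_pair_eq_span_singleton u v T hvu
  have h𝔪₂ : (Ideal.span {u, v}).map (algebraMap A Γ₂) = Ideal.span {algebraMap A Γ₂ v} := by
    rw [Set.pair_comm]; exact map_span_pair_eq_span_singleton v u T' huv
  subst hI₁ hI₂ hI₁₂
  have hJ₁ : Ideal.span {algebraMap A Γ₁ u ^ 2} ≤ Ideal.span {algebraMap A Γ₁ u} :=
    Ideal.span_singleton_le_span_singleton.mpr (Dvd.intro_left _ (pow_two _).symm)
  have hJ₂ : Ideal.span {algebraMap A Γ₂ v ^ 2} ≤ Ideal.span {algebraMap A Γ₂ v} :=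
    Ideal.span_singleton_le_span_singleton.mpr (Dvd.intro_left _ (pow_two _).symm)
  -- the reduction `M₂ → M₁` and the structure maps `σᵢ : A → Mᵢ`
  let red : (Γ₁ ⧸ Ideal.span {algebraMap A Γ₁ u ^ 2}) × (Γ₂ ⧸ Ideal.span {algebraMap A Γ₂ v ^ 2})
      →ₗ[A] (Γ₁ ⧸ Ideal.span {algebraMap A Γ₁ u}) × (Γ₂ ⧸ Ideal.span {algebraMap A Γ₂ v}) :=
    (Ideal.Quotient.factorₐ A hJ₁).toLinearMap.prodMap (Ideal.Quotient.factorₐ A hJ₂).toLinearMap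
  have hred_mk : ∀ (a : Γ₁) (b : Γ₂), red (Ideal.Quotient.mk _ a, Ideal.Quotient.mk _ b) =
      (Ideal.Quotient.mk _ a, Ideal.Quotient.mk _ b) := fun a b => rfl
  let σ₁ : A →ₗ[A] (Γ₁ ⧸ Ideal.span {algebraMap A Γ₁ u}) × (Γ₂ ⧸ Ideal.span {algebraMap A Γ₂ v}) :=
    Algebra.linearMap A _
  let σ₂ : A →ₗ[A]
      (Γ₁ ⧸ Ideal.span {algebraMap A Γ₁ u ^ 2}) × (Γ₂ ⧸ Ideal.span {algebraMap A Γ₂ v ^ 2}) :=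
    Algebra.linearMap A _
  have hσ₁_apply : ∀ c, σ₁ c = (Ideal.Quotient.mk _ (algebraMap A Γ₁ c),
      Ideal.Quotient.mk _ (algebraMap A Γ₂ c)) := fun c => rfl
  have hσ₂_apply : ∀ c, σ₂ c = (Ideal.Quotient.mk _ (algebraMap A Γ₁ c),
      Ideal.Quotient.mk _ (algebraMap A Γ₂ c)) := fun c => rfl
  have hredσ : ∀ c, red (σ₂ c) = σ₁ c := fun c => rfl
  have hσ₂E : ∀ c, σ₂ c ∈ E := fun c => by
    rw [hσ₂_apply, hE, AlgHom.commutes, AlgHom.commutes, sub_self]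
    exact zero_mem _
  have hker₁ : LinearMap.ker σ₁ = (Ideal.span {u, v}).restrictScalars A :=
    ker_linearMap_eq_span_pair u v T ε₁ hε₁C hvu _ rfl _ h𝔪₂.le
  -- `red(E) ⊆ range σ₁`
  have hredE : ∀ z ∈ E, red z ∈ LinearMap.range σ₁ := by
    intro z hz
    obtain ⟨a, ha⟩ := Ideal.Quotient.mk_surjective z.1
    obtain ⟨b, hb⟩ := Ideal.Quotient.mk_surjective z.2
    have hz2 : z = (Ideal.Quotient.mk _ a, Ideal.Quotient.mk _ b) := by rw [ha, hb]
    rw [hz2] at hz ⊢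
    have hab : r₁ a - r₂ b ∈ Ideal.span {algebraMap A Γ₁₂ u} :=
      Ideal.span_singleton_le_span_singleton.mpr
        (Dvd.intro_left _ (pow_two (algebraMap A Γ₁₂ u)).symm) ((hE a b).mp hz)
    obtain ⟨c, hca, hcb⟩ := exists_sub_algebraMap_mem r₁ r₂ u v T T' ε₁ hε₁C hε₁X ε₂ hε₂C hε₂X
      hvu huv hu hr₁ hloc hgen₁ hgen₂ hTT' a b hab
    refine ⟨c, ?_⟩
    rw [hred_mk, hσ₁_apply, Prod.ext_iff, Ideal.Quotient.eq, Ideal.Quotient.eq]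
    exact ⟨by rw [← neg_sub]; exact Submodule.neg_mem _ hca,
      by rw [← neg_sub]; exact Submodule.neg_mem _ hcb⟩
  obtain ⟨red', hred'_apply⟩ : ∃ f : E →ₗ[A] LinearMap.range σ₁,
      ∀ z : E, ((f z : LinearMap.range σ₁) : (Γ₁ ⧸ Ideal.span {algebraMap A Γ₁ u}) × (Γ₂ ⧸ Ideal.span {algebraMap A Γ₂ v})) = red z :=
    ⟨(red.domRestrict E).codRestrict _ (fun z => hredE z z.2), fun z => rfl⟩
  have hred'_surj : Function.Surjective red' := by
    rintro ⟨y, c, rfl⟩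
    exact ⟨⟨σ₂ c, hσ₂E c⟩, Subtype.ext (by rw [hred'_apply]; exact hredσ c)⟩
  -- the kernel of `red'` is `λ(A × A) ≅ (A/𝔪)²`
  have hlin : IsLinearMap A (fun αβ : A × A =>
      ((Ideal.Quotient.mk (Ideal.span {algebraMap A Γ₁ u ^ 2})
          (algebraMap A Γ₁ u * (algebraMap A Γ₁ αβ.1 + algebraMap A Γ₁ αβ.2 * T)),
        Ideal.Quotient.mk (Ideal.span {algebraMap A Γ₂ v ^ 2})
          (algebraMap A Γ₂ v * (algebraMap A Γ₂ αβ.2 + algebraMap A Γ₂ αβ.1 * T'))) : (Γ₁ ⧸ Ideal.span {algebraMap A Γ₁ u ^ 2}) × (Γ₂ ⧸ Ideal.span {algebraMap A Γ₂ v ^ 2}))) := by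
    constructor
    · intro x y
      refine Prod.ext ?_ ?_
      · change Ideal.Quotient.mk _ _ = Ideal.Quotient.mk _ _ + Ideal.Quotient.mk _ _
        rw [← map_add]; congr 1; simp only [Prod.fst_add, Prod.snd_add, map_add]; ring
      · change Ideal.Quotient.mk _ _ = Ideal.Quotient.mk _ _ + Ideal.Quotient.mk _ _
        rw [← map_add]; congr 1; simp only [Prod.fst_add, Prod.snd_add, map_add]; ring
    · intro c x
      refine Prod.ext ?_ ?_
      · change Ideal.Quotient.mk _ _ = c • Ideal.Quotient.mk _ _
        conv_rhs => rw [Algebra.smul_def, algebraMap_quotient_apply, ← map_mul]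
        congr 1
        simp only [Prod.smul_fst, Prod.smul_snd, smul_eq_mul, map_mul]; ring
      · change Ideal.Quotient.mk _ _ = c • Ideal.Quotient.mk _ _
        conv_rhs => rw [Algebra.smul_def, algebraMap_quotient_apply, ← map_mul]
        congr 1
        simp only [Prod.smul_fst, Prod.smul_snd, smul_eq_mul, map_mul]; ring
  obtain ⟨lam, hlam_apply⟩ : ∃ f : A × A →ₗ[A] (Γ₁ ⧸ Ideal.span {algebraMap A Γ₁ u ^ 2}) × (Γ₂ ⧸ Ideal.span {algebraMap A Γ₂ v ^ 2}), ∀ αβ : A × A, f αβ =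
      (Ideal.Quotient.mk _ (algebraMap A Γ₁ u * (algebraMap A Γ₁ αβ.1 + algebraMap A Γ₁ αβ.2 * T)),
        Ideal.Quotient.mk _
          (algebraMap A Γ₂ v * (algebraMap A Γ₂ αβ.2 + algebraMap A Γ₂ αβ.1 * T'))) :=
    ⟨IsLinearMap.mk' _ hlin, fun _ => rfl⟩
  have hlamE : ∀ αβ, lam αβ ∈ E := fun αβ => by
    rw [hlam_apply, hE, r_lam_sub_eq_zero r₁ r₂ u v T T' hvu hTT']
    exact zero_mem _
  have hlam_red : ∀ αβ, red (lam αβ) = 0 := fun αβ => by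
    rw [hlam_apply, hred_mk, Prod.mk_eq_zero, Ideal.Quotient.eq_zero_iff_mem,
      Ideal.Quotient.eq_zero_iff_mem]
    exact ⟨Ideal.mul_mem_right _ _ (Ideal.subset_span rfl),
      Ideal.mul_mem_right _ _ (Ideal.subset_span rfl)⟩
  -- the kernel part, as the submodule `K₀ = E ⊓ ker red` of `M₂`
  have hK₀ : ∀ z, z ∈ E ⊓ LinearMap.ker red ↔ z ∈ E ∧ red z = 0 := fun z => by
    rw [Submodule.mem_inf, LinearMap.mem_ker]
  obtain ⟨lamK, hlamK_apply⟩ : ∃ f : A × A →ₗ[A] ↥(E ⊓ LinearMap.ker red),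
      ∀ αβ, ((f αβ : ↥(E ⊓ LinearMap.ker red)) : (Γ₁ ⧸ Ideal.span {algebraMap A Γ₁ u ^ 2}) × (Γ₂ ⧸ Ideal.span {algebraMap A Γ₂ v ^ 2})) = lam αβ :=
    ⟨lam.codRestrict _ (fun αβ => (hK₀ _).mpr ⟨hlamE αβ, hlam_red αβ⟩), fun _ => rfl⟩
  have hlamK_surj : Function.Surjective lamK := by
    rintro ⟨z, hz⟩
    obtain ⟨hzE, hzK'⟩ := (hK₀ z).mp hz
    obtain ⟨a, ha⟩ := Ideal.Quotient.mk_surjective z.1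
    obtain ⟨b, hb⟩ := Ideal.Quotient.mk_surjective z.2
    have hz2 : z = (Ideal.Quotient.mk _ a, Ideal.Quotient.mk _ b) := by rw [ha, hb]
    subst hz2
    rw [hred_mk, Prod.mk_eq_zero, Ideal.Quotient.eq_zero_iff_mem, Ideal.Quotient.eq_zero_iff_mem]
      at hzK'
    obtain ⟨α, β, hα, hβ⟩ := exists_lam_sub_mem r₁ r₂ u v T T' ε₁ hε₁C hε₁X ε₂ hε₂C hε₂X hvu huv
      hu hr₁ hloc hgen₁ hgen₂ hTT' a b hzK'.1 hzK'.2 ((hE a b).mp hzE)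
    refine ⟨(α, β), Subtype.ext ?_⟩
    rw [hlamK_apply, hlam_apply, Prod.ext_iff, Ideal.Quotient.eq, Ideal.Quotient.eq]
    exact ⟨by rw [← neg_sub]; exact Submodule.neg_mem _ hα,
      by rw [← neg_sub]; exact Submodule.neg_mem _ hβ⟩
  have hlamK_ker : LinearMap.ker lamK =
      ((Ideal.span {u, v}).restrictScalars A).prod ((Ideal.span {u, v}).restrictScalars A) := by
    ext αβ
    rw [LinearMap.mem_ker, Submodule.mem_prod, Submodule.restrictScalars_mem,
      Submodule.restrictScalars_mem]
    have : lamK αβ = 0 ↔ lam αβ = 0 := by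
      constructor
      · intro h; rw [← hlamK_apply, h]; rfl
      · intro h; exact Subtype.ext (by rw [hlamK_apply, h]; rfl)
    rw [this, hlam_apply, Prod.mk_eq_zero, Ideal.Quotient.eq_zero_iff_mem,
      Ideal.Quotient.eq_zero_iff_mem,
      mul_linear_mem_span_sq_iff (Ideal.span {u, v}) u T ε₁ hε₁C hε₁X h𝔪₁ hu₁,
      mul_linear_mem_span_sq_iff (Ideal.span {u, v}) v T' ε₂ hε₂C hε₂X h𝔪₂ hv₂]
    tauto
  -- exactness of `K₀ ↪ E ↠ range σ₁`
  have hexact : Function.Exact (Submodule.inclusion (inf_le_left : E ⊓ LinearMap.ker red ≤ E))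
      red' := by
    rw [LinearMap.exact_iff]
    ext z
    rw [LinearMap.mem_ker, Submodule.range_inclusion, Submodule.mem_comap, Submodule.subtype_apply,
      hK₀]
    constructor
    · intro h
      refine ⟨z.2, ?_⟩
      rw [← hred'_apply, h]; rfl
    · rintro ⟨-, h⟩
      exact Subtype.ext (by rw [hred'_apply, h]; rfl)
  -- `(A × A)/(𝔪 × 𝔪) ≅ (A/𝔪) × (A/𝔪)`
  let π₂ : A × A →ₗ[A] (A ⧸ (Ideal.span {u, v}).restrictScalars A) ×
      (A ⧸ (Ideal.span {u, v}).restrictScalars A) :=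
    ((Ideal.span {u, v}).restrictScalars A).mkQ.prodMap ((Ideal.span {u, v}).restrictScalars A).mkQ
  have hπ₂_surj : Function.Surjective π₂ :=
    Function.Surjective.prodMap (Submodule.mkQ_surjective _) (Submodule.mkQ_surjective _)
  have hπ₂_ker : LinearMap.ker π₂ =
      ((Ideal.span {u, v}).restrictScalars A).prod ((Ideal.span {u, v}).restrictScalars A) := by
    rw [LinearMap.ker_prodMap, Submodule.ker_mkQ]
  have eK₁ : ((A × A) ⧸ LinearMap.ker lamK) ≃ₗ[A] ↥(E ⊓ LinearMap.ker red) :=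
    lamK.quotKerEquivOfSurjective hlamK_surj
  have eK₂ : ((A × A) ⧸ LinearMap.ker lamK) ≃ₗ[A] ((A × A) ⧸ LinearMap.ker π₂) :=
    Submodule.quotEquivOfEq _ _ (hlamK_ker.trans hπ₂_ker.symm)
  have eK₃ : ((A × A) ⧸ LinearMap.ker π₂) ≃ₗ[A] (A ⧸ (Ideal.span {u, v}).restrictScalars A) ×
      (A ⧸ (Ideal.span {u, v}).restrictScalars A) :=
    π₂.quotKerEquivOfSurjective hπ₂_surj
  -- `range σ₁ ≅ A/𝔪`
  have e₁ : (A ⧸ (Ideal.span {u, v}).restrictScalars A) ≃ₗ[A] LinearMap.range σ₁ :=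
    (Submodule.quotEquivOfEq _ _ hker₁.symm).trans σ₁.quotKerEquivRange
  -- lengths
  have hlen := Module.length_eq_add_of_exact
    ((Submodule.inclusion (inf_le_left : E ⊓ LinearMap.ker red ≤ E)).restrictScalars S)
    (red'.restrictScalars S)
    (Submodule.inclusion_injective (inf_le_left : E ⊓ LinearMap.ker red ≤ E)) hred'_surj hexact
  rw [hlen, ← (eK₁.restrictScalars S).length_eq, (eK₂.restrictScalars S).length_eq,
    (eK₃.restrictScalars S).length_eq, Module.length_prod, ← (e₁.restrictScalars S).length_eq]
  have h3 : (3 : ℕ∞) = 1 + 1 + 1 := by norm_num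
  rw [h3, add_mul, add_mul, one_mul]
  rfl

end Lengths

end Summit.ResolutionOfSingularities.ResolutionOfSingularities.Theorems.NoZeno.ExcCount.PointBlowup

end
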